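import Mathlib
import Summits.ValiantsHypothesis.ValiantsHypothesis.Theses.RefutationDegree
import Literature.Computability.AlgebraicComplexity.OrbitClosure
import Literature.Computability.AlgebraicComplexity.BorderDcQuadraticBound

/-!
# Sketch — crux RefutationBarrier, idea `contact-exponent` (crux-ideate round 1, ideator 2)

Scratch declarations only (planner sketch; nothing here is a tree item).
`HasSosRefutation n m d` is the crux's inlined Hermitian-SOS predicate with `n ^ c ↦ d`
(checked against the route decl by `rb_iff` below, `Iff.rfl`).
-/

open scoped BigOperators
open Filter Topology

namespace Summit.ValiantsHypothesis.ValiantsHypothesis.Cruxes.RefutationBarrier.ContactExponent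

open Literature.Computability.AlgebraicComplexity

/-- The defect `P = det(A₀ + Σ_e x_e A_e) − per_n(x)`, a polynomial in `x` whose coefficients are
polynomials (of degree `m`, plus constants) in the `(n²+1)m²` unknown entries. -/
noncomputable def defect (n m : ℕ) :
    MvPolynomial (Fin n × Fin n) (MvPolynomial (Option (Fin n × Fin n) × (Fin m × Fin m)) ℂ) :=
  (Matrix.of fun i j : Fin m => MvPolynomial.C (MvPolynomial.X (none, (i, j))) +
      ∑ e : Fin n × Fin n, MvPolynomial.X e * MvPolynomial.C (MvPolynomial.X (some e, (i, j))) :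
    Matrix (Fin m) (Fin m)
      (MvPolynomial (Fin n × Fin n) (MvPolynomial (Option (Fin n × Fin n) × (Fin m × Fin m)) ℂ))).det -
  MvPolynomial.map MvPolynomial.C (perPoly (Fin n) ℂ)

/-- Rep(n,m) has a Hermitian-SOS (complexified real Positivstellensatz) refutation with all products
of total degree `≤ d` — the crux's predicate, verbatim, with `n ^ c ↦ d`. -/
def HasSosRefutation (n m d : ℕ) : Prop :=
  (let P : MvPolynomial (Fin n × Fin n) (MvPolynomial (Option (Fin n × Fin n) × (Fin m × Fin m)) ℂ) := (Matrix.of fun i j : Fin m => MvPolynomial.C (MvPolynomial.X (none, (i, j))) + ∑ e : Fin n × Fin n, MvPolynomial.X e * MvPolynomial.C (MvPolynomial.X (some e, (i, j))) : Matrix (Fin m) (Fin m) (MvPolynomial (Fin n × Fin n) (MvPolynomial (Option (Fin n × Fin n) × (Fin m × Fin m)) ℂ))).det - MvPolynomial.map MvPolynomial.C (Literature.Computability.AlgebraicComplexity.perPoly (Fin n) ℂ); let eqn : ((Fin n × Fin n) →₀ ℕ) → MvPolynomial ((Option (Fin n × Fin n) × (Fin m × Fin m)) ⊕ (Option (Fin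 n × Fin n) × (Fin m × Fin m))) ℂ := fun μ => MvPolynomial.rename Sum.inl (P.coeff μ); let cj : MvPolynomial ((Option (Fin n × Fin n) × (Fin m × Fin m)) ⊕ (Option (Fin n × Fin n) × (Fin m × Fin m))) ℂ → MvPolynomial ((Option (Fin n × Fin n) × (Fin m × Fin m)) ⊕ (Option (Fin n × Fin n) × (Fin m × Fin m))) ℂ := fun p => MvPolynomial.rename Sum.swap (MvPolynomial.map (starRingEnd ℂ) p); ∃ (k : ℕ) (q : Fin k → MvPolynomial ((Option (Fin n × Fin n) × (Fin m × Fin m)) ⊕ (Option (Fin n × Fin n) × (Fin m × Fin m))) ℂ) (h : ((Fin n × Fin n) →₀ ℕ) → MvPolynomial ((Option (Fin n × Fin n) × (Fin m × Fin m)) ⊕ (Option (Fin n × Fin n) × (Fin m × Fin m))) ℂ), (∀ i, (q i * cj (q i)).totalDegree ≤ d) ∧ (∀ μ, (h μ * eqn μ).totalDegree ≤ d) ∧ ∑ i, q i * cj (q i) + ∑ μ ∈ P.support, (h μ * eqn μ + cj (h μ * eqn μ)) + 1 = 0)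

/-- Rep(n,m) has a Nullstellensatz refutation `Σ_μ h_μ · eq_μ = 1` with all products of degree `≤ d`
(the NS predicate of `BeyondHessianNs` / `MrCalibration`, with general `n m d`). -/
def HasNsRefutation (n m d : ℕ) : Prop :=
  ∃ h : ((Fin n × Fin n) →₀ ℕ) → MvPolynomial (Option (Fin n × Fin n) × (Fin m × Fin m)) ℂ,
    (∀ μ, (h μ * (defect n m).coeff μ).totalDegree ≤ d) ∧
      ∑ μ ∈ (defect n m).support, h μ * (defect n m).coeff μ = 1

/-- Sanity: the crux is literally `∀ c ∃ n₀ ∀ n ≥ n₀ ∀ m ≥ n²/2+1, ¬ HasSosRefutation n m (n^c)`. -/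
theorem rb_iff :
    Theses.RefutationDegree.RefutationBarrier ↔
      ∀ c : ℕ, ∃ n₀ : ℕ, ∀ n ≥ n₀, ∀ m : ℕ, n ^ 2 / 2 + 1 ≤ m → ¬ HasSosRefutation n m (n ^ c) :=
  Iff.rfl

/-- FAST APPROXIMATE SOLUTIONS of Rep(n,m) relative to degree `d`: a sequence of size-`m` affine
pencils `a_k` (points of `ℂ^{(n²+1)m²}`) whose defect tends to `0` faster than `(1 + ‖a_k‖)^(d−m)`
grows. Laurent pencils `a(t)` with pole order `p` and `det A_t(x) ≡ per_n(x) mod t^K`, `K > p(d−m)`,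
give such sequences (`a_k := a(1/k)`); so does an honest representation (constant sequence). -/
def HasFastApprox (n m d : ℕ) : Prop :=
  ∃ a : ℕ → (Option (Fin n × Fin n) × (Fin m × Fin m) → ℂ),
    Tendsto (fun k => (∑ μ ∈ (defect n m).support,
        ‖MvPolynomial.eval (a k) ((defect n m).coeff μ)‖) * (1 + ‖a k‖) ^ (d - m)) atTop (𝓝 0)

/-- FIRST LEMMA (S1, "analytic dual"; elementary): fast approximate solutions kill every Hermitian-SOS
refutation of degree `≤ d` — evaluate the identity at `(a_k, conj a_k)`: `Σ_i |q_i|² + 2 Re Σ_μ h_μ eq_μ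
+ 1 = 0`, and `|h_μ(a_k, ā_k)| ≤ ‖h_μ‖₁ (1+‖a_k‖)^(d−m)` while `eq_μ(a_k) → 0` fast. Positivity is
free because evaluation at a conjugate pair is a positive Hermitian functional. -/
def AnalyticDual : Prop :=
  ∀ n m d : ℕ, HasFastApprox n m d → ¬ HasSosRefutation n m d

/-- S3 (padding monotonicity): substituting `A ↦ diag(A, 1)` (i.e. `A₀ ↦ A₀ ⊕ 1`, `A_e ↦ A_e ⊕ 0`)
into a refutation of Rep(n,m+1) gives one of Rep(n,m) of the same degree; hence the crux reduces to
the single size `m* = n²/2+1`. -/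
def PadMonotone : Prop :=
  ∀ n m d : ℕ, HasSosRefutation n (m + 1) d → HasSosRefutation n m d

/-- C⁺ (SUPER-CONTACT at the Hessian size): for every `c`, for all large `n`, Rep(n, ⌊n²/2⌋+1) has
fast approximate solutions relative to degree `n^c` — per_n osculates the size-(n²/2+1) determinantal
border to every polynomial order. -/
def SuperContact : Prop :=
  ∀ c : ℕ, ∃ n₀ : ℕ, ∀ n ≥ n₀, HasFastApprox n (n ^ 2 / 2 + 1) (n ^ c)

/-- TRANSFER (easy direction): C⁺ ⇒ the crux, through the first lemma and padding. -/
def Transfer : Prop :=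
  AnalyticDual → PadMonotone → SuperContact → Theses.RefutationDegree.RefutationBarrier

/-- The transfer is pure logic once `AnalyticDual` and `PadMonotone` are in hand. -/
theorem transfer_holds : Transfer := by
  intro hdual hpad hsc c
  obtain ⟨n₀, hn₀⟩ := hsc c
  refine ⟨n₀, fun n hn m hm => ?_⟩
  -- climb down from m to n²/2+1 by padding, then apply the analytic dual
  have key : ∀ j : ℕ, ¬ HasSosRefutation n (n ^ 2 / 2 + 1 + j) (n ^ c) := by
    intro j
    induction j with
    | zero => simpa using hdual n (n ^ 2 / 2 + 1) (n ^ c) (hn₀ n hn)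
    | succ j ih => exact fun h => ih (hpad n (n ^ 2 / 2 + 1 + j) (n ^ c) h)
  obtain ⟨j, rfl⟩ := Nat.exists_eq_add_of_le hm
  exact key j

/-- S2+S4 (the deep half; valuative criterion for integral closure + Briançon–Skoda in `ℂ[a, a_h]`):
if `per_n` is NOT in the closure of size-`m` affine determinantal expressions (border-infeasible:
`¬ HasBorderDetRepr ℂ n m`, `n ≤ m`), then Rep(n,m) has a Nullstellensatz refutation of degree
`≤ m·((n²+1)m² + 1)`. -/
def BorderGivesCertificate : Prop :=
  ∀ n m : ℕ, ∀ _ : NeZero m, n ≤ m → ¬ HasBorderDetRepr ℂ n m →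
    HasNsRefutation n m (m * ((n ^ 2 + 1) * m ^ 2 + 1))

/-- CONDITIONAL REFUTATION of the crux (for the disprover): a border lower bound
`borderdc(per_n) ≥ ⌊n²/2⌋ + 2` for infinitely many `n` — a "+2" over Landsberg–Manivel–Ressayre's
`LMR2013_thm_1_1_1` (`≥ n²/2`) — kills RefutationBarrier, via `BorderGivesCertificate` and the
route's own support item `NsToSos`. -/
def CruxFalseOfBorderGap : Prop :=
  BorderGivesCertificate → Theses.RefutationDegree.NsToSos →
    (∀ n₀ : ℕ, ∃ n ≥ n₀, ¬ HasBorderDetRepr ℂ n (n ^ 2 / 2 + 1)) →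
      ¬ Theses.RefutationDegree.RefutationBarrier

/-- What the crux FORCES (contrapositive reading): cofinitely, `borderdc(per_n) ≤ ⌊n²/2⌋ + 1`. -/
def CruxForcesBorderUpperBound : Prop :=
  BorderGivesCertificate → Theses.RefutationDegree.NsToSos →
    Theses.RefutationDegree.RefutationBarrier → ∃ n₀ : ℕ, ∀ n ≥ n₀, HasBorderDetRepr ℂ n (n ^ 2 / 2 + 1)

end Summit.ValiantsHypothesis.ValiantsHypothesis.Cruxes.RefutationBarrier.ContactExponent
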